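import Summits.BirchSwinnertonDyer.Uniform.U2.GenusCongruence
import Literature.NumberTheory.EllipticCurves.HeegnerPointsGaloisDescent
import Literature.NumberTheory.EllipticCurves.LeadingTerm
import Literature.NumberTheory.EllipticCurves.BSDSelmerCMPConverseRankOneProofs
import Literature.NumberTheory.EllipticCurves.ComplexMultiplication
import Literature.NumberTheory.EllipticCurves.BSDRootNumberModularityOnlyProofs
import HarnessLib

/-!
# Cell «bsd-uniform», track U2, route C — Theorem A′ SHAPE of the «a_q-odd combination at 2»,
# pending R-AN: the genus point `P(χ_M)` has infinite order (PROVED from `GenusCongruence` +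
# Galois descent), and the RANK TRANSPORT it drives (conditional on the named analytic inputs —
# referee V7: no booking word until R-AN is assembled from CST 2014 Thm 1.1 under its printed
# binders + a proved genus factorisation + the tree's root-number parity — and on GZK)

HONEST FRAMING (cell «bsd-uniform», run/shared/lean/pub/bsd-uniform/, seat u2-p3): the target of
the cell is a CONDUCTOR-FREE, CLASS-LEVEL `BSD(E,2)` statement; this file is NOT that and claims no
case of the Birch–Swinnerton-Dyer conjecture. It is a RELATIVE (transport) statement, uniform in the
twisting parameter `d` and ANCHORED on per-base inputs that are per-curve by nature (PLAN.md §2 U2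
"HONEST SCOPE"; referee PROTOCOL L6): the Heegner base datum `(E, K, y_K)` with (H-y)
`y_K ∉ 2E(K)`. Every arithmetic input is an explicit binder; nothing is asserted. Inputs and their
status:
* PROVED here / in `GenusCongruence.lean` (the step NOT IN PRINT, P2-SUBLANE.md l.42 (5)): the
  parity transport `y_K ∉ 2E(K) ⇒ P(χ_M) ∉ E(H_M)_tors` (§1), from the composed norm relation, the
  absence of `2`-torsion over `H_M`, and Galois descent `E(H_M)^{Gal(H_M/K)} = E(K)` (tree theorem
  `exists_map_eq_of_forall_map_galois_eq`).
* NAMED HYPOTHESES (printed, to be matched with u2-lit's `Uniform/U2/Ingredients.lean` stubs):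
  `htr` — the composed norm relation `Tr_{H_M/K} P_M = m · y_K`, `m` odd (for `M` a product of
  INERT `a_q`-odd primes: Coates–Li–Tian–Zhai 2015 Lemma 2.9 and the "general fact first observed by
  Kolyvagin" [arXiv:1312.3884 p0008 L34–L48], Bradshaw–Stein 2012 §3 `Tr_{K_c/K} y_c = a_c y_K`,
  `m = ∏ a_q`; Gross 1991 Prop. 3.7 (1) prints the same relation but under (3.1)–(3.3), referee
  ADVISORY A2; for SPLIT primes Darmon CBMS 101 Prop. 3.10 composed by
  `GenusCongruence.sum_eq_sub_two_smul_sum_quotient_of_trace_eq`, `m = ∏ (a_q − 2)`);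
  `h2L` — "`E(H_M)[2] = 0`" (T4-PROOF L1: elementary from `E(ℚ)[2] = 0` and `K ≠ ℚ(√Δ_E)`, NOT yet
  a kernel theorem — RESIDUE.md §U2 row R-L1);
  `hdich` — the ANALYTIC DICHOTOMY "`P(χ_M)` of infinite order ⇒ `{r_an(E^{(d)}), r_an(E^{(d·d_K)})}
  = {0,1}`" (Cai–Shu–Tian 2014 Thm 1.1, tree `CaiShuTian2014.thm11_ringClassChar`, + positivity of
  `ĥ_K` on non-torsion points + the genus factorisation `L(s,E,χ_M) = L(E^{(d)},s)·L(E^{(d·d_K)},s)`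
  + sign `−1`; Nekovář 2007 Thm 3.2 gives only FINITENESS of the `χ`-parts, referee ADVISORY A3 —
  RESIDUE.md §U2 row R-AN until typed/proved);
  `hGZK` — Gross–Zagier–Kolyvagin over `ℚ` (tree named fact
  `rank_eq_analyticRank_of_analyticRank_le_one`).
* PROVED here (§3): the calculus `L(W₁,1)L(W₂,1) = 0 ∧ (L(W₁,·)L(W₂,·))′(1) ≠ 0 ⇒ {r_an} = {0,1}`
  (`analyticRank_dichotomy_of_deriv_mul_ne_zero`), so that `hdich` splits into the printed atoms
  `hLderiv` (CST 1.1 + height positivity + genus factorisation) and `hsign` (root numbers, route B):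
  `rankPart_genusTwist_of_deriv_ne_zero`.
* WHAT IS NOT HERE: the sign rule pinning WHICH member has rank one (`χ_d(−N)`; route B, u2-p2),
  `Ш[2]` (Thm B′) and `BSD₂` (Cor C) of the members (route B), the cell bookkeeping and the residue
  predicates (`Uniform/U2/Residue.lean`, this seat).

WHY THIS IS NOVEL (one sentence, PLAN.md §2): every printed `2`-part result for non-CM curves
(CLTZ 2015, Cai–Li–Zhai 2020, Kriz–Li 2019, Zhai 2016) runs an `a_q`-EVEN / `2`-divisibility
lower-bound engine or needs `2` split in `K` with (★), whereas this line transports EXACT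
`2`-indivisibility of `y_K` through the genus character with `a_q` odd, inert or split alike.

References: Cai–Shu–Tian, ANT 8 (2014) Thm 1.1 [CaiShuTian2014]; Coates–Li–Tian–Zhai, PLMS 110
(2015) Lemma 2.9 [CoatesLiTianZhai2015]; Darmon, CBMS 101 (2004) Prop. 3.10 [Darmon2004]; Gross, LMS
LNS 153 (1991) Prop. 3.7, Thm 1.3 [GrossLMS1991]; Nekovář, LMS LNS 320 (2007) Thm 3.2 [Nekovar2007];
Kriz–Li, FMS 7 (2019) Thm 4.3 (the split-prime, (★) neighbour) [KrizLi2019];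
b2b/bsd-rank1-residual/p2/idea-2/T4-PROOF.md v1.9b §§3–4.
-/

noncomputable section

open scoped Classical

open WeierstrassCurve Literature.NumberTheory.EllipticCurves

set_option autoImplicit false

namespace Summit.BirchSwinnertonDyer.Uniform.U2

universe u

section Data

variable (W : WeierstrassCurve ℚ) {K : Type} [Field K] [NumberField K]
  {L : Type} [Field L] [NumberField L] [Algebra K L] [FiniteDimensional K L]

omit [FiniteDimensional K L] in
/-- The two base-change idioms of the tree agree: pushing a `K`-point to `L` along
`(algebraMap K L).toRatAlgHom` (the idiom of `HeegnerPointsGaloisDescent`) is Mathlib's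
`Affine.Point.baseChange K L` (`= map (Algebra.ofId K L)`). [folklore] -/
theorem map_toRatAlgHom_eq_baseChange (P : (W.baseChange K).toAffine.Point) :
    WeierstrassCurve.Affine.Point.map (W' := W) (algebraMap K L).toRatAlgHom P =
      WeierstrassCurve.Affine.Point.baseChange (W' := W) K L P := by
  cases P <;> rfl

/-! ## §1 The genus point has infinite order (Theorem A′, first half — PROVED) -/

/-- **THE GENUS POINT `P(χ_M)` HAS INFINITE ORDER** (T4-PROOF Theorem A, first half; the step the
«bsd-p2» literature verdict found not in print, here a kernel theorem). Data: `E/ℚ` (model `W`),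
`K` a number field (the Heegner field), `L/K` finite Galois (the ring class field `H_M`),
`y_K ∈ E(K)` (the Heegner point), `P_M ∈ E(L)` (the Heegner point of conductor `M`),
`χ : Gal(L/K) → {±1}` (the genus character `χ_M`; ANY sign function works). Hypotheses:
`h2L : E(L)[2] = 0` (T4-PROOF L1); (H-y) `y_K ∉ 2E(K)`; the composed norm relation
`∑_{σ ∈ Gal(L/K)} σ P_M = m · y_K` with `m` ODD (CLTZ 2015 Lemma 2.9 / Bradshaw–Stein 2012 §3 for
inert `a_q`-odd primes, `m = ∏ a_q`; Darmon 2004 Prop. 3.10 composed for split ones). Conclusion: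
`P(χ) = ∑_σ χ(σ) · σ P_M` is not a torsion point. Proof: `GenusCongruence.not_isOfFinAddOrder_genusPoint`
with Galois descent (`exists_map_eq_of_forall_map_galois_eq`) converting "(H-y) in `E(K)`" into
"`y_K` is not twice a `Gal(L/K)`-fixed point of `E(L)`". [folklore] -/
theorem genusPoint_not_isOfFinAddOrder [IsGalois K L]
    (yK : (W.baseChange K).toAffine.Point) (PM : (W.baseChange L).toAffine.Point)
    (h2L : ∀ Q : (W.baseChange L).toAffine.Point, (2 : ℕ) • Q = 0 → Q = 0)
    (hHy : ¬ ∃ R : (W.baseChange K).toAffine.Point, (2 : ℕ) • R = yK)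
    (χ : (L ≃ₐ[K] L) → ℤˣ) {m : ℤ} (hm : Odd m)
    (htr : ∑ σ : L ≃ₐ[K] L, WeierstrassCurve.Affine.Point.map (W' := W) (σ : L →ₐ[K] L) PM =
      m • WeierstrassCurve.Affine.Point.baseChange (W' := W) K L yK) :
    ¬ IsOfFinAddOrder
      (∑ σ : L ≃ₐ[K] L, (χ σ : ℤ) • WeierstrassCurve.Affine.Point.map (W' := W) (σ : L →ₐ[K] L) PM) := by
  -- the family of additive maps `σ ↦ (P ↦ σP)` on `A = E(L)`
  let ρ : (L ≃ₐ[K] L) → AddMonoid.End (W.baseChange L).toAffine.Point := fun σ =>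
    WeierstrassCurve.Affine.Point.map (W' := W) (σ : L →ₐ[K] L)
  set y : (W.baseChange L).toAffine.Point :=
    WeierstrassCurve.Affine.Point.baseChange (W' := W) K L yK with hy_def
  have hy : ∀ σ : L ≃ₐ[K] L, ρ σ y = y := fun σ =>
    WeierstrassCurve.Affine.Point.map_baseChange (W' := W) (σ : L →ₐ[K] L) yK
  have hndiv : ¬ ∃ R : (W.baseChange L).toAffine.Point,
      (∀ σ : L ≃ₐ[K] L, ρ σ R = R) ∧ (2 : ℕ) • R = y := by
    rintro ⟨R, hRfix, hR2⟩
    obtain ⟨R₀, hR₀⟩ := exists_map_eq_of_forall_map_galois_eq (k := K) (L := L) W (P := R) hRfix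
    apply hHy
    refine ⟨R₀, ?_⟩
    apply WeierstrassCurve.Affine.Point.map_injective (W' := W) ((algebraMap K L).toRatAlgHom)
    rw [map_nsmul, hR₀, hR2, hy_def, map_toRatAlgHom_eq_baseChange]
  exact GenusCongruence.not_isOfFinAddOrder_genusPoint ρ h2L hy hndiv χ hm htr

end Data

/-! ## §2 The rank transport (Theorem A′, ranks — conditional on `hdich` and GZK) -/

/-- **RANK TRANSPORT ALONG THE a_q-ODD GENUS TWIST** (T4-PROOF Theorem A / idea-2
`thmAPrime_rank_genusTwist` without the sign clause). For the data of `genusPoint_not_isOfFinAddOrder`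
and globally minimal models `W₁`, `W₂` of the two genus twists `E^{(d)}`, `E^{(d·d_K)}` (`|d| = M`,
`d ≡ 1 (mod 4)`): GRANTED the analytic dichotomy `hdich` ("`P(χ_M)` of infinite order ⇒ the analytic
ranks of the two members are `{0, 1}`" — CST 2014 Thm 1.1 + height positivity + genus factorisation
+ sign; a NAMED HYPOTHESIS, RESIDUE row R-AN) and Gross–Zagier–Kolyvagin over `ℚ` (`hGZK`), both
members satisfy the rank part of BSD with finite `Ш`, one of analytic rank `1` and the other `0`.
Conditional on the per-base certificate (H-y) — a RELATIVE uniform statement (referee PROTOCOL L6).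
[folklore] -/
theorem rankPart_genusTwist_of_dichotomy
    (W : WeierstrassCurve ℚ) [W.IsElliptic] {K : Type} [Field K] [NumberField K]
    {L : Type} [Field L] [NumberField L] [Algebra K L] [FiniteDimensional K L] [IsGalois K L]
    (yK : (W.baseChange K).toAffine.Point) (PM : (W.baseChange L).toAffine.Point)
    (h2L : ∀ Q : (W.baseChange L).toAffine.Point, (2 : ℕ) • Q = 0 → Q = 0)
    (hHy : ¬ ∃ R : (W.baseChange K).toAffine.Point, (2 : ℕ) • R = yK)
    (χ : (L ≃ₐ[K] L) → ℤˣ) {m : ℤ} (hm : Odd m)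
    (htr : ∑ σ : L ≃ₐ[K] L, WeierstrassCurve.Affine.Point.map (W' := W) (σ : L →ₐ[K] L) PM =
      m • WeierstrassCurve.Affine.Point.baseChange (W' := W) K L yK)
    (hGZK : rank_eq_analyticRank_of_analyticRank_le_one)
    (d : ℤ) (W₁ W₂ : WeierstrassCurve ℚ) [W₁.IsElliptic] [W₂.IsElliptic]
    (hW₁ : ∃ C : VariableChange ℚ, C • W₁ = W.quadraticTwist (d : ℚ))
    (hW₂ : ∃ C : VariableChange ℚ, C • W₂ = W.quadraticTwist ((d * NumberField.discr K : ℤ) : ℚ))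
    (hdich : (∃ C : VariableChange ℚ, C • W₁ = W.quadraticTwist (d : ℚ)) →
      (∃ C : VariableChange ℚ, C • W₂ = W.quadraticTwist ((d * NumberField.discr K : ℤ) : ℚ)) →
      ¬ IsOfFinAddOrder
        (∑ σ : L ≃ₐ[K] L, (χ σ : ℤ) •
          WeierstrassCurve.Affine.Point.map (W' := W) (σ : L →ₐ[K] L) PM) →
      (W₁.analyticRank = 1 ∧ W₂.analyticRank = 0) ∨ (W₁.analyticRank = 0 ∧ W₂.analyticRank = 1)) :
    W₁.mordellWeilRank = W₁.analyticRank ∧ W₂.mordellWeilRank = W₂.analyticRank ∧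
      Finite W₁.sha ∧ Finite W₂.sha ∧
      ((W₁.analyticRank = 1 ∧ W₂.analyticRank = 0) ∨
        (W₁.analyticRank = 0 ∧ W₂.analyticRank = 1)) := by
  have hP := genusPoint_not_isOfFinAddOrder W yK PM h2L hHy χ hm htr
  have hd := hdich hW₁ hW₂ hP
  have hr₁ : W₁.analyticRank ≤ 1 := by rcases hd with ⟨h, -⟩ | ⟨h, -⟩ <;> omega
  have hr₂ : W₂.analyticRank ≤ 1 := by rcases hd with ⟨-, h⟩ | ⟨-, h⟩ <;> omega
  obtain ⟨e₁, f₁⟩ := hGZK W₁ hr₁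
  obtain ⟨e₂, f₂⟩ := hGZK W₂ hr₂
  exact ⟨e₁, e₂, f₁, f₂, hd⟩

/-! ## §3 The analytic dichotomy from a simple zero of the product (PROVED), and the rank
transport with the analytic inputs split into printed atoms -/

/-- **ANALYTIC DICHOTOMY FROM A SIMPLE ZERO OF THE PRODUCT** (the calculus inside T4-PROOF Theorem A,
second half: "`L′(1,E,χ_M) = L(X₊,1)·L′(X₋,1) ≠ 0` forces `L(X₊,1) ≠ 0` and `L′(X₋,1) ≠ 0`"). For
two elliptic curves over `ℚ` (entire `L`-functions by modularity `hmod`): if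
`L(W₁,1)·L(W₂,1) = 0` (the sign: `w(E^{(d)})·w(E^{(d·d_K)}) = −1`, route B) and the derivative of
the product `L(W₁,s)·L(W₂,s)` at `s = 1` is nonzero (CST 2014 Thm 1.1 + height positivity + the
genus factorisation), then the analytic ranks are `{0, 1}`: one member has `r_an = 1`, the other
`r_an = 0`. [folklore] -/
theorem analyticRank_dichotomy_of_deriv_mul_ne_zero (hmod : hasEntireLFunction_rat)
    (W₁ W₂ : WeierstrassCurve ℚ) [W₁.IsElliptic] [W₂.IsElliptic]
    (hzero : W₁.entireLFunction 1 * W₂.entireLFunction 1 = 0)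
    (hderiv : deriv (fun s => W₁.entireLFunction s * W₂.entireLFunction s) 1 ≠ 0) :
    (W₁.analyticRank = 1 ∧ W₂.analyticRank = 0) ∨ (W₁.analyticRank = 0 ∧ W₂.analyticRank = 1) := by
  have hE₁ : W₁.HasEntireLFunction := hmod W₁
  have hE₂ : W₂.HasEntireLFunction := hmod W₂
  have hd₁ : DifferentiableAt ℂ W₁.entireLFunction 1 :=
    (W₁.differentiable_entireLFunction hE₁).differentiableAt
  have hd₂ : DifferentiableAt ℂ W₂.entireLFunction 1 :=
    (W₂.differentiable_entireLFunction hE₂).differentiableAt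
  have hprod : deriv (fun s => W₁.entireLFunction s * W₂.entireLFunction s) 1 =
      deriv W₁.entireLFunction 1 * W₂.entireLFunction 1 +
        W₁.entireLFunction 1 * deriv W₂.entireLFunction 1 := deriv_mul hd₁ hd₂
  rcases mul_eq_zero.mp hzero with h₁ | h₂
  · -- `L(W₁,1) = 0`: the derivative of the product is `L′(W₁,1)·L(W₂,1)`
    rw [hprod, h₁, zero_mul, add_zero] at hderiv
    have hder₁ : deriv W₁.entireLFunction 1 ≠ 0 := left_ne_zero_of_mul hderiv
    have hval₂ : W₂.entireLFunction 1 ≠ 0 := right_ne_zero_of_mul hderiv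
    exact Or.inl ⟨analyticRank_eq_one_of_entireLFunction_one_eq_zero_of_deriv_ne_zero W₁ hE₁ h₁ hder₁,
      analyticRank_eq_zero_of_entireLFunction_one_ne_zero W₂ hval₂⟩
  · rw [hprod, h₂, mul_zero, zero_add] at hderiv
    have hval₁ : W₁.entireLFunction 1 ≠ 0 := left_ne_zero_of_mul hderiv
    have hder₂ : deriv W₂.entireLFunction 1 ≠ 0 := right_ne_zero_of_mul hderiv
    exact Or.inr ⟨analyticRank_eq_zero_of_entireLFunction_one_ne_zero W₁ hval₁,
      analyticRank_eq_one_of_entireLFunction_one_eq_zero_of_deriv_ne_zero W₂ hE₂ h₂ hder₂⟩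

/-- **The sign atom.** If one of two elliptic curves over `ℚ` has root number `−1` (for the genus
pair: `w(E^{(d)})·w(E^{(d·d_K)}) = w(E)·w(E^{(d_K)}) = χ_{d_K}(−N) = −1`, route B / Kriz–Li Cor. 5.2),
then `L(W₁,1)·L(W₂,1) = 0`: an odd functional equation forces an odd — hence nonzero — order of
vanishing (tree: `even_analyticRank_iff_rootNumber_eq_one_of_exists_isNewformOf`, from the
Modularity theorem `exists_isNewformOf`), and a nonzero order means `L(·,1) = 0`
(`analyticRank_eq_zero_of_entireLFunction_one_ne_zero`). [folklore] -/
theorem entireLFunction_one_mul_eq_zero_of_rootNumber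
    (hmod : Literature.NumberTheory.EllipticCurves.ModularForms.exists_isNewformOf)
    (W₁ W₂ : WeierstrassCurve ℚ) [W₁.IsElliptic] [W₂.IsElliptic]
    (hw : W₁.rootNumber = -1 ∨ W₂.rootNumber = -1) :
    W₁.entireLFunction 1 * W₂.entireLFunction 1 = 0 := by
  have key : ∀ (V : WeierstrassCurve ℚ) [V.IsElliptic], V.rootNumber = -1 →
      V.entireLFunction 1 = 0 := by
    intro V _ hV
    by_contra hL
    have h0 : V.analyticRank = 0 := analyticRank_eq_zero_of_entireLFunction_one_ne_zero V hL
    have hev : Even V.analyticRank := by rw [h0]; exact ⟨0, rfl⟩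
    have h1 : V.rootNumber = 1 :=
      (even_analyticRank_iff_rootNumber_eq_one_of_exists_isNewformOf V hmod).mp hev
    rw [h1] at hV
    norm_num at hV
  rcases hw with h | h
  · rw [key W₁ h, zero_mul]
  · rw [key W₂ h, mul_zero]

/-- **RANK TRANSPORT, analytic inputs as printed atoms.** As `rankPart_genusTwist_of_dichotomy`, but
the dichotomy binder is replaced by its two printed constituents in analytic currency:
`hLderiv` — "`P(χ_M)` of infinite order ⇒ `(L(E^{(d)},s)·L(E^{(d·d_K)},s))′(1) ≠ 0`" (Cai–Shu–Tian
2014 Thm 1.1, tree `CaiShuTian2014.thm11_ringClassChar`, whose right-hand side `ĥ_K(P⁰_χ(f))` is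
positive exactly when `P(χ)` is non-torsion, read through the genus factorisation
`L(s,E,χ_M) = L(E^{(d)},s)·L(E^{(d·d_K)},s)` — RESIDUE row R2-10 until the factorisation is typed)
and `hsign` — "`L(E^{(d)},1)·L(E^{(d·d_K)},1) = 0`" (root numbers multiply to `−1`; route B). The
calculus in between is `analyticRank_dichotomy_of_deriv_mul_ne_zero` (proved). [folklore] -/
theorem rankPart_genusTwist_of_deriv_ne_zero
    (W : WeierstrassCurve ℚ) [W.IsElliptic] {K : Type} [Field K] [NumberField K]
    {L : Type} [Field L] [NumberField L] [Algebra K L] [FiniteDimensional K L] [IsGalois K L]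
    (yK : (W.baseChange K).toAffine.Point) (PM : (W.baseChange L).toAffine.Point)
    (h2L : ∀ Q : (W.baseChange L).toAffine.Point, (2 : ℕ) • Q = 0 → Q = 0)
    (hHy : ¬ ∃ R : (W.baseChange K).toAffine.Point, (2 : ℕ) • R = yK)
    (χ : (L ≃ₐ[K] L) → ℤˣ) {m : ℤ} (hm : Odd m)
    (htr : ∑ σ : L ≃ₐ[K] L, WeierstrassCurve.Affine.Point.map (W' := W) (σ : L →ₐ[K] L) PM =
      m • WeierstrassCurve.Affine.Point.baseChange (W' := W) K L yK)
    (hmod : hasEntireLFunction_rat) (hGZK : rank_eq_analyticRank_of_analyticRank_le_one)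
    (W₁ W₂ : WeierstrassCurve ℚ) [W₁.IsElliptic] [W₂.IsElliptic]
    (hLderiv : ¬ IsOfFinAddOrder
        (∑ σ : L ≃ₐ[K] L, (χ σ : ℤ) •
          WeierstrassCurve.Affine.Point.map (W' := W) (σ : L →ₐ[K] L) PM) →
      deriv (fun s => W₁.entireLFunction s * W₂.entireLFunction s) 1 ≠ 0)
    (hsign : W₁.entireLFunction 1 * W₂.entireLFunction 1 = 0) :
    W₁.mordellWeilRank = W₁.analyticRank ∧ W₂.mordellWeilRank = W₂.analyticRank ∧
      Finite W₁.sha ∧ Finite W₂.sha ∧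
      ((W₁.analyticRank = 1 ∧ W₂.analyticRank = 0) ∨
        (W₁.analyticRank = 0 ∧ W₂.analyticRank = 1)) := by
  have hP := genusPoint_not_isOfFinAddOrder W yK PM h2L hHy χ hm htr
  have hd := analyticRank_dichotomy_of_deriv_mul_ne_zero hmod W₁ W₂ hsign (hLderiv hP)
  have hr₁ : W₁.analyticRank ≤ 1 := by rcases hd with ⟨h, -⟩ | ⟨h, -⟩ <;> omega
  have hr₂ : W₂.analyticRank ≤ 1 := by rcases hd with ⟨-, h⟩ | ⟨-, h⟩ <;> omega
  obtain ⟨e₁, f₁⟩ := hGZK W₁ hr₁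
  obtain ⟨e₂, f₂⟩ := hGZK W₂ hr₂
  exact ⟨e₁, e₂, f₁, f₂, hd⟩

end Summit.BirchSwinnertonDyer.Uniform.U2

end
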